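import Literature.Computability.Complexity.ProjectionGameIso
import Literature.Computability.Complexity.LabelCover
import HarnessLib

/-!
# Finite bipartite label cover instances: products, powers, blow-up, and the list format

Topic `Computability/Complexity`, namespace `Literature.Computability.Complexity.BLC`.  The
combinatorial (index-arithmetic) layer between projection games (`ProjectionGames.lean`,
Dinur–Steurer 2014) and the tree's list-encoded label cover instances `LabelCoverInstance`
(`LabelCover.lean`, Arora–Barak 2009, Def. 22.1/§22.3), for the proof of the NP-hardness of
`gapLabelCover W ε` for every `ε > 0` (Arora–Barak Thm. 22.15 via Dinur–Steurer §3.3):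

* `BLC` — a bipartite label cover instance with TOTAL projections on `Fin`-indexed data: `nB` vertices
  of Bob, `nA` of Alice, alphabets `[WB]`, `[WA]`, `m` edges `src e — dst e` with `proj e : [WB] → [WA]`,
  both endpoint maps onto; `BLC.game` — the same as a unit-weight `ProjGame`.
* `BLC.prod`, `BLC.unit`, `BLC.npow` — the product / one-point / `k`-fold product instances in mixed
  radix (`finProdFinEquiv`), with `isoProd`, `isoUnit`, `isoNpow` — game isomorphisms
  (`ProjectionGameIso.lean`) onto `ProjGame.prod`, `ProjGame.unit`, `ProjGame.pow`, so that
  Dinur–Steurer's bound for `G^{⊗k}` and satisfiability transfer (`Iso.valLe_iff`, `Iso.sat_iff`).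
* `BLC.blowA c` — Alice-side blow-up (every vertex of Alice replaced by `c` copies seeing the same
  edges): preserves `val ≤ θ` (`valLe_blowA`) and satisfiability, multiplies Bob's degrees by `c` and
  keeps Alice's (`degB_blowA`, `degA_blowA`) — used to make bi-regular instances regular in the sense of
  `LabelCoverInstance.IsRegular` ("every variable appears in the same number of constraints").
* degrees: `degB`, `degA`, and their behaviour under `prod`/`npow`/`blowA`.
* `BLC.toLC` — the list rendering: variables `0 … nB-1` (Bob) and `nB … nB+nA-1` (Alice), alphabet
  `WB`, constraint `e ↦ (src e, nB + dst e, [proj e 0, …, proj e (WB-1)])`; `wellFormed_toLC`,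
  `isRegular_toLC`, `isSatisfiable_toLC`, and **`satCount_toLC_le`**: if `val(game) ≤ θ` then every
  assignment `a : ℕ → ℕ` satisfies at most `θ · m` constraints of `toLC` (labels out of range satisfy
  nothing; in-range labels are strategies).

## References

* S. Arora, B. Barak, *Computational Complexity: A Modern Approach*, CUP 2009: Def. 22.1, §22.3
  (projection property, regular instances), Thm. 22.15, §22.3.1 (the instance `φ^{*t}`).
* I. Dinur, D. Steurer, *Analytical approach to parallel repetition*, STOC 2014; arXiv:1305.1979,
  §2.2 (`G ⊗ H`), §3.3, Claim 8.1 ("(c, d)-regular" games).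
-/

namespace Literature.Computability.Complexity

open Finset

/-- A **finite bipartite label cover instance** with total projections: Bob's vertices `Fin nB` with
labels `Fin WB`, Alice's vertices `Fin nA` with labels `Fin WA`, edges `Fin m` with endpoints `src`,
`dst` (both onto) and projections `proj e : Fin WB → Fin WA`. [cite: AroraBarakCC2009, Def. 22.1 and §22.3 (projection property)] -/
structure BLC where
  /-- number of Bob's vertices -/
  nB : ℕ
  /-- number of Alice's vertices -/
  nA : ℕ
  /-- Bob's alphabet size -/
  WB : ℕ
  /-- Alice's alphabet size -/
  WA : ℕ
  /-- number of edges (constraints) -/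
  m : ℕ
  /-- Bob's endpoint -/
  src : Fin m → Fin nB
  /-- Alice's endpoint -/
  dst : Fin m → Fin nA
  /-- the projection of an edge -/
  proj : Fin m → Fin WB → Fin WA
  /-- every vertex of Bob lies on an edge -/
  src_surj : Function.Surjective src
  /-- every vertex of Alice lies on an edge -/
  dst_surj : Function.Surjective dst

namespace BLC

/-! ### The game of an instance -/

/-- The instance as a unit-weight projection game. [cite: DinurSteurer2014, §2.1] -/
def game (I : BLC) : ProjGame (Fin I.m) (Fin I.nB) (Fin I.nA) (Fin I.WB) (Fin I.WA) where
  src := I.src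
  dst := I.dst
  proj e b := some (I.proj e b)
  wt _ := 1
  wt_pos _ := one_pos
  src_surj := I.src_surj
  dst_surj := I.dst_surj

/-- `src` of the game (definitional). [folklore] -/
@[simp] theorem game_src (I : BLC) (e : Fin I.m) : I.game.src e = I.src e := rfl
/-- `dst` of the game (definitional). [folklore] -/
@[simp] theorem game_dst (I : BLC) (e : Fin I.m) : I.game.dst e = I.dst e := rfl
/-- `proj` of the game (definitional). [folklore] -/
@[simp] theorem game_proj (I : BLC) (e : Fin I.m) (b : Fin I.WB) : I.game.proj e b = some (I.proj e b) := rfl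
/-- weights of the game (definitional). [folklore] -/
@[simp] theorem game_wt (I : BLC) (e : Fin I.m) : I.game.wt e = 1 := rfl

/-- The total weight of the game is the number of edges. [folklore] -/
theorem total_game (I : BLC) : I.game.total = I.m := by
  simp [ProjGame.total]

/-- The satisfied weight of the game is the number of satisfied edges. [folklore] -/
theorem satW_game (I : BLC) (b : Fin I.nB → Fin I.WB) (a : Fin I.nA → Fin I.WA) :
    I.game.satW b a = ((univ.filter fun e : Fin I.m => I.proj e (b (I.src e)) = a (I.dst e)).card : ℝ) := by
  unfold ProjGame.satW
  rw [natCast_card_filter]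
  refine sum_congr rfl fun e _ => ?_
  simp only [game_proj, game_src, game_dst, game_wt, Option.some.injEq]

/-- Perfect strategies of the game, spelled out. [folklore] -/
theorem game_sat_iff (I : BLC) (b : Fin I.nB → Fin I.WB) (a : Fin I.nA → Fin I.WA) :
    (∀ e, I.game.proj e (b (I.game.src e)) = some (a (I.game.dst e))) ↔ ∀ e, I.proj e (b (I.src e)) = a (I.dst e) := by
  simp

/-! ### Degrees -/

/-- The degree of Bob's vertex `v` (number of edges at `v`). [cite: AroraBarakCC2009, §22.3 (regular instances)] -/
def degB (I : BLC) (v : Fin I.nB) : ℕ := (univ.filter fun e : Fin I.m => I.src e = v).card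

/-- The degree of Alice's vertex `u`. [cite: AroraBarakCC2009, §22.3 (regular instances)] -/
def degA (I : BLC) (u : Fin I.nA) : ℕ := (univ.filter fun e : Fin I.m => I.dst e = u).card

/-! ### Products -/

/-- **The product instance** `I ⊗ J` in mixed radix: vertices, labels and edges are pairs coded by
`finProdFinEquiv`, the projection acts componentwise. [cite: DinurSteurer2014, §2.2; AroraBarakCC2009, §22.3.1 (φ^{*t})] -/
@[reducible] def prod (I J : BLC) : BLC where
  nB := I.nB * J.nB
  nA := I.nA * J.nA
  WB := I.WB * J.WB
  WA := I.WA * J.WA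
  m := I.m * J.m
  src e := finProdFinEquiv (I.src (finProdFinEquiv.symm e).1, J.src (finProdFinEquiv.symm e).2)
  dst e := finProdFinEquiv (I.dst (finProdFinEquiv.symm e).1, J.dst (finProdFinEquiv.symm e).2)
  proj e b := finProdFinEquiv
    (I.proj (finProdFinEquiv.symm e).1 (finProdFinEquiv.symm b).1, J.proj (finProdFinEquiv.symm e).2 (finProdFinEquiv.symm b).2)
  src_surj v := by
    obtain ⟨e₁, h₁⟩ := I.src_surj (finProdFinEquiv.symm v).1
    obtain ⟨e₂, h₂⟩ := J.src_surj (finProdFinEquiv.symm v).2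
    refine ⟨finProdFinEquiv (e₁, e₂), ?_⟩
    simp only [Equiv.symm_apply_apply, h₁, h₂, Prod.mk.eta, Equiv.apply_symm_apply]
  dst_surj u := by
    obtain ⟨e₁, h₁⟩ := I.dst_surj (finProdFinEquiv.symm u).1
    obtain ⟨e₂, h₂⟩ := J.dst_surj (finProdFinEquiv.symm u).2
    refine ⟨finProdFinEquiv (e₁, e₂), ?_⟩
    simp only [Equiv.symm_apply_apply, h₁, h₂, Prod.mk.eta, Equiv.apply_symm_apply]

/-- **`(I ⊗ J).game ≅ I.game ⊗ J.game`** (decode every index into its pair of components). [cite: DinurSteurer2014, §2.2] -/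
def isoProd (I J : BLC) : ProjGame.Iso (I.prod J).game (I.game.prod J.game) where
  eE := finProdFinEquiv.symm
  eV := finProdFinEquiv.symm
  eU := finProdFinEquiv.symm
  eβ := finProdFinEquiv.symm
  eα := finProdFinEquiv.symm
  src_eq e := by
    show (I.src (finProdFinEquiv.symm e).1, J.src (finProdFinEquiv.symm e).2) = finProdFinEquiv.symm ((I.prod J).src e)
    simp
  dst_eq e := by
    show (I.dst (finProdFinEquiv.symm e).1, J.dst (finProdFinEquiv.symm e).2) = finProdFinEquiv.symm ((I.prod J).dst e)
    simp
  proj_eq e b := by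
    show ProjGame.prodProj (fun x => some (I.proj (finProdFinEquiv.symm e).1 x)) (fun y => some (J.proj (finProdFinEquiv.symm e).2 y))
        (finProdFinEquiv.symm b) = (some ((I.prod J).proj e b)).map finProdFinEquiv.symm
    simp [ProjGame.prodProj, prod]
  wt_eq e := by
    show (1 : ℝ) * 1 = 1
    rw [one_mul]

/-- Counting pairs by components: `#{e : Fin (p q) | P e₁ ∧ Q e₂} = #{P} · #{Q}`. [folklore] -/
theorem card_filter_finProd {p q : ℕ} (P : Fin p → Prop) (Q : Fin q → Prop) [DecidablePred P] [DecidablePred Q] :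
    (univ.filter fun e : Fin (p * q) => P (finProdFinEquiv.symm e).1 ∧ Q (finProdFinEquiv.symm e).2).card =
      (univ.filter P).card * (univ.filter Q).card := by
  rw [← card_product, ← filter_product]
  refine card_equiv finProdFinEquiv.symm fun e => ?_
  simp only [mem_filter, mem_univ, true_and, mem_product]

/-- An index equals `v` iff its components are those of `v`. [folklore] -/
theorem finProdFinEquiv_eq_iff {p q : ℕ} (x : Fin p × Fin q) (v : Fin (p * q)) :
    finProdFinEquiv x = v ↔ x.1 = (finProdFinEquiv.symm v).1 ∧ x.2 = (finProdFinEquiv.symm v).2 := by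
  rw [← Prod.ext_iff, ← Equiv.eq_symm_apply]

/-- Bob's degrees multiply in a product. [folklore] -/
theorem degB_prod (I J : BLC) (v : Fin (I.prod J).nB) :
    (I.prod J).degB v = I.degB (finProdFinEquiv.symm v).1 * J.degB (finProdFinEquiv.symm v).2 := by
  unfold degB
  rw [← card_filter_finProd]
  congr 1
  ext e
  simp only [mem_filter, mem_univ, true_and]
  exact finProdFinEquiv_eq_iff _ v

/-- Alice's degrees multiply in a product. [folklore] -/
theorem degA_prod (I J : BLC) (u : Fin (I.prod J).nA) :
    (I.prod J).degA u = I.degA (finProdFinEquiv.symm u).1 * J.degA (finProdFinEquiv.symm u).2 := by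
  unfold degA
  rw [← card_filter_finProd]
  congr 1
  ext e
  simp only [mem_filter, mem_univ, true_and]
  exact finProdFinEquiv_eq_iff _ u

/-! ### The one-point instance and powers -/

/-- The one-point instance (one edge, one vertex and one label on each side). [folklore] -/
@[reducible] def unit : BLC where
  nB := 1
  nA := 1
  WB := 1
  WA := 1
  m := 1
  src _ := 0
  dst _ := 0
  proj _ _ := 0
  src_surj v := ⟨0, (Fin.fin_one_eq_zero v).symm⟩
  dst_surj u := ⟨0, (Fin.fin_one_eq_zero u).symm⟩

/-- `unit.game ≅ ProjGame.unit`. [folklore] -/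
def isoUnit : ProjGame.Iso unit.game ProjGame.unit where
  eE := finOneEquiv
  eV := finOneEquiv
  eU := finOneEquiv
  eβ := finOneEquiv
  eα := finOneEquiv
  src_eq _ := rfl
  dst_eq _ := rfl
  proj_eq _ _ := rfl
  wt_eq _ := rfl

/-- Degrees of the one-point instance. [folklore] -/
theorem degB_unit (v : Fin unit.nB) : unit.degB v = 1 := by
  unfold degB
  simp [Fin.fin_one_eq_zero v]

/-- Degrees of the one-point instance (Alice). [folklore] -/
theorem degA_unit (u : Fin unit.nA) : unit.degA u = 1 := by
  unfold degA
  simp [Fin.fin_one_eq_zero u]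

/-- **The `k`-fold product instance** `I^{⊗k} = I ⊗ (I ⊗ ⋯ ⊗ unit)`. [cite: AroraBarakCC2009, §22.3.1 (φ^{*t}); DinurSteurer2014, §2.2] -/
def npow (I : BLC) : ℕ → BLC
  | 0 => unit
  | k + 1 => I.prod (npow I k)

/-- `I^{⊗0} = unit`. [folklore] -/
@[simp] theorem npow_zero (I : BLC) : I.npow 0 = unit := rfl

/-- `I^{⊗(k+1)} = I ⊗ I^{⊗k}`. [folklore] -/
@[simp] theorem npow_succ (I : BLC) (k : ℕ) : I.npow (k + 1) = I.prod (I.npow k) := rfl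

/-- **`(I^{⊗k}).game ≅ (I.game)^{⊗k}`**. [cite: DinurSteurer2014, §2.2] -/
def isoNpow (I : BLC) : (k : ℕ) → ProjGame.Iso (I.npow k).game (I.game.pow k)
  | 0 => isoUnit
  | k + 1 => (I.isoProd (I.npow k)).trans ((ProjGame.Iso.refl I.game).prod (isoNpow I k))

/-- Sizes of the power: Bob's vertices. [folklore] -/
@[simp] theorem nB_npow (I : BLC) : ∀ k, (I.npow k).nB = I.nB ^ k
  | 0 => rfl
  | k + 1 => by rw [npow_succ, pow_succ']; exact congrArg (I.nB * ·) (nB_npow I k)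

/-- Sizes of the power: Alice's vertices. [folklore] -/
@[simp] theorem nA_npow (I : BLC) : ∀ k, (I.npow k).nA = I.nA ^ k
  | 0 => rfl
  | k + 1 => by rw [npow_succ, pow_succ']; exact congrArg (I.nA * ·) (nA_npow I k)

/-- Sizes of the power: Bob's alphabet. [folklore] -/
@[simp] theorem WB_npow (I : BLC) : ∀ k, (I.npow k).WB = I.WB ^ k
  | 0 => rfl
  | k + 1 => by rw [npow_succ, pow_succ']; exact congrArg (I.WB * ·) (WB_npow I k)

/-- Sizes of the power: Alice's alphabet. [folklore] -/
@[simp] theorem WA_npow (I : BLC) : ∀ k, (I.npow k).WA = I.WA ^ k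
  | 0 => rfl
  | k + 1 => by rw [npow_succ, pow_succ']; exact congrArg (I.WA * ·) (WA_npow I k)

/-- Sizes of the power: edges. [folklore] -/
@[simp] theorem m_npow (I : BLC) : ∀ k, (I.npow k).m = I.m ^ k
  | 0 => rfl
  | k + 1 => by rw [npow_succ, pow_succ']; exact congrArg (I.m * ·) (m_npow I k)

/-- **Regularity is preserved by powers** (Bob): if all of Bob's degrees are `D`, those of `I^{⊗k}` are `D^k`. [cite: DinurSteurer2014, Claim 8.1 ((c,d)-regular games)] -/
theorem degB_npow (I : BLC) {D : ℕ} (h : ∀ v, I.degB v = D) : ∀ (k : ℕ) (v : Fin (I.npow k).nB), (I.npow k).degB v = D ^ k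
  | 0, v => by rw [pow_zero]; exact degB_unit v
  | k + 1, v => by
    rw [pow_succ']
    show (I.prod (I.npow k)).degB v = D * D ^ k
    rw [degB_prod, h, degB_npow I h k]

/-- **Regularity is preserved by powers** (Alice). [cite: DinurSteurer2014, Claim 8.1 ((c,d)-regular games)] -/
theorem degA_npow (I : BLC) {D : ℕ} (h : ∀ u, I.degA u = D) : ∀ (k : ℕ) (u : Fin (I.npow k).nA), (I.npow k).degA u = D ^ k
  | 0, u => by rw [pow_zero]; exact degA_unit u
  | k + 1, u => by
    rw [pow_succ']
    show (I.prod (I.npow k)).degA u = D * D ^ k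
    rw [degA_prod, h, degA_npow I h k]

/-! ### Alice-side blow-up -/

/-- **Alice-side blow-up**: every vertex `u` of Alice becomes `c` copies `(u, j)`, every edge `e` becomes
the `c` edges `(e, j)` from `src e` to `(dst e, j)` with the same projection. [cite: DinurSteurer2014, Claim 8.1 (making a game (c, 2d)-regular by duplicating vertices)] -/
@[reducible] def blowA (I : BLC) (c : ℕ) (hc : 0 < c) : BLC where
  nB := I.nB
  nA := I.nA * c
  WB := I.WB
  WA := I.WA
  m := I.m * c
  src e := I.src (finProdFinEquiv.symm e).1
  dst e := finProdFinEquiv (I.dst (finProdFinEquiv.symm e).1, (finProdFinEquiv.symm e).2)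
  proj e := I.proj (finProdFinEquiv.symm e).1
  src_surj v := by
    obtain ⟨e, he⟩ := I.src_surj v
    exact ⟨finProdFinEquiv (e, ⟨0, hc⟩), by simp [he]⟩
  dst_surj u := by
    obtain ⟨e, he⟩ := I.dst_surj (finProdFinEquiv.symm u).1
    refine ⟨finProdFinEquiv (e, (finProdFinEquiv.symm u).2), ?_⟩
    simp only [Equiv.symm_apply_apply, he, Prod.mk.eta, Equiv.apply_symm_apply]

/-- Summing over the edges of the blow-up = summing over (edge, copy). [folklore] -/
theorem sum_blowA {M : Type*} [AddCommMonoid M] (I : BLC) (c : ℕ) (F : Fin (I.m * c) → M) :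
    ∑ e, F e = ∑ e : Fin I.m, ∑ j : Fin c, F (finProdFinEquiv (e, j)) := by
  rw [← Equiv.sum_comp finProdFinEquiv, Fintype.sum_prod_type]

/-- **The blow-up does not increase the value**: `val(I) ≤ θ ⇒ val(blowA I) ≤ θ` (for each copy index `j`,
Alice's answers on the `j`-th copies form a strategy of `I`). [cite: DinurSteurer2014, Claim 8.1] -/
theorem valLe_blowA (I : BLC) (c : ℕ) (hc : 0 < c) {θ : ℝ} (h : I.game.ValLe θ) : (I.blowA c hc).game.ValLe θ := by
  intro b a
  rw [total_game]
  have hsat : (I.blowA c hc).game.satW b a = ∑ j : Fin c, I.game.satW b (fun u => a (finProdFinEquiv (u, j))) := by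
    unfold ProjGame.satW
    rw [sum_blowA, sum_comm]
    refine sum_congr rfl fun j _ => sum_congr rfl fun e _ => ?_
    simp only [game_proj, game_src, game_dst, game_wt, blowA, Equiv.symm_apply_apply]
  rw [hsat]
  calc ∑ j : Fin c, I.game.satW b (fun u => a (finProdFinEquiv (u, j))) ≤ ∑ _j : Fin c, θ * I.m :=
        sum_le_sum fun j _ => (h b _).trans (by rw [total_game])
    _ = θ * ((I.blowA c hc).m : ℕ) := by
        rw [sum_const, card_univ, Fintype.card_fin, nsmul_eq_mul]
        show (c : ℝ) * (θ * I.m) = θ * ((I.m * c : ℕ) : ℝ)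
        push_cast; ring

/-- The blow-up of a satisfiable instance is satisfiable. [folklore] -/
theorem sat_blowA (I : BLC) (c : ℕ) (hc : 0 < c) {b : Fin I.nB → Fin I.WB} {a : Fin I.nA → Fin I.WA}
    (h : ∀ e, I.proj e (b (I.src e)) = a (I.dst e)) :
    ∀ e, (I.blowA c hc).proj e (b ((I.blowA c hc).src e)) = (fun u => a (finProdFinEquiv.symm u).1) ((I.blowA c hc).dst e) := by
  intro e
  simp [blowA, h]

/-- Bob's degrees are multiplied by `c`. [cite: DinurSteurer2014, Claim 8.1] -/
theorem degB_blowA (I : BLC) (c : ℕ) (hc : 0 < c) (v : Fin (I.blowA c hc).nB) : (I.blowA c hc).degB v = I.degB v * c := by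
  unfold degB
  have h := card_filter_finProd (fun e : Fin I.m => I.src e = v) (fun _ : Fin c => True)
  rw [filter_true, card_univ, Fintype.card_fin] at h
  rw [← h]
  congr 1
  ext e
  simp only [mem_filter, mem_univ, true_and, and_true]

/-- Alice's copies keep the degree of their original. [cite: DinurSteurer2014, Claim 8.1] -/
theorem degA_blowA (I : BLC) (c : ℕ) (hc : 0 < c) (u : Fin (I.blowA c hc).nA) :
    (I.blowA c hc).degA u = I.degA (finProdFinEquiv.symm u).1 := by
  unfold degA
  have h := card_filter_finProd (fun e : Fin I.m => I.dst e = (finProdFinEquiv.symm u).1)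
    (fun j : Fin c => j = (finProdFinEquiv.symm u).2)
  rw [filter_eq', if_pos (mem_univ _), card_singleton, mul_one] at h
  rw [← h]
  congr 1
  ext e
  simp only [mem_filter, mem_univ, true_and]
  exact finProdFinEquiv_eq_iff _ u

/-! ### The list format -/

/-- **The list rendering** of an instance: variables `0, …, nB - 1` are Bob's vertices, `nB, …, nB + nA - 1`
Alice's; alphabet `WB`; the constraint of edge `e` is `(src e, nB + dst e, [proj e 0, …, proj e (WB - 1)])`.
[cite: AroraBarakCC2009, Def. 22.1 and §22.3 (projection property: h as a function [W] → [W])] -/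
def toLC (I : BLC) : LabelCoverInstance where
  numVars := I.nB + I.nA
  alphabetSize := I.WB
  constraints := (List.finRange I.m).map fun e =>
    ⟨I.src e, I.nB + I.dst e, (List.finRange I.WB).map fun u => (I.proj e u : ℕ)⟩

/-- The constraint of edge `e`. [folklore] -/
def con (I : BLC) (e : Fin I.m) : LabelCoverConstraint :=
  ⟨I.src e, I.nB + I.dst e, (List.finRange I.WB).map fun u => (I.proj e u : ℕ)⟩

/-- The constraint list of `toLC` is `[con 0, …, con (m-1)]`. [folklore] -/
theorem toLC_constraints (I : BLC) : I.toLC.constraints = (List.finRange I.m).map I.con := rfl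

/-- `toLC` has `m` constraints. [folklore] -/
@[simp] theorem numConstraints_toLC (I : BLC) : I.toLC.numConstraints = I.m := by
  simp [LabelCoverInstance.numConstraints, toLC]

/-- `toLC` has alphabet `WB` (definitional). [folklore] -/
@[simp] theorem alphabetSize_toLC (I : BLC) : I.toLC.alphabetSize = I.WB := rfl

/-- `toLC` has `nB + nA` variables (definitional). [folklore] -/
@[simp] theorem numVars_toLC (I : BLC) : I.toLC.numVars = I.nB + I.nA := rfl

/-- Membership in the constraint list. [folklore] -/
theorem mem_constraints_toLC (I : BLC) {C : LabelCoverConstraint} : C ∈ I.toLC.constraints ↔ ∃ e, I.con e = C := by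
  simp [toLC_constraints, List.mem_map, List.mem_finRange]

/-- Counting over `finRange`: `countP q [0, …, m-1] = #{e | q e}`. [folklore] -/
theorem countP_finRange {k : ℕ} (q : Fin k → Bool) :
    (List.finRange k).countP q = (univ.filter fun e : Fin k => q e = true).card := by
  rw [List.countP_eq_length_filter, ← List.toFinset_card_of_nodup ((List.nodup_finRange k).filter _),
    List.toFinset_filter, List.toFinset_finRange]

/-- **Well-formedness** of the list rendering (given `m ≥ 1` and `WA ≤ WB`). [cite: AroraBarakCC2009, Def. 22.1 and §22.3] -/
theorem wellFormed_toLC (I : BLC) (hm : 0 < I.m) (hW : I.WA ≤ I.WB) : I.toLC.WellFormed := by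
  refine ⟨by rwa [numConstraints_toLC], fun C hC => ?_⟩
  obtain ⟨e, rfl⟩ := (mem_constraints_toLC I).1 hC
  refine ⟨?_, ?_, ?_, ?_, ?_⟩
  · show (I.src e : ℕ) < I.nB + I.nA
    exact lt_of_lt_of_le (I.src e).isLt (Nat.le_add_right _ _)
  · show I.nB + (I.dst e : ℕ) < I.nB + I.nA
    exact Nat.add_lt_add_left (I.dst e).isLt _
  · show (I.src e : ℕ) ≠ I.nB + I.dst e
    exact Nat.ne_of_lt (lt_of_lt_of_le (I.src e).isLt (Nat.le_add_right _ _))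
  · show ((List.finRange I.WB).map fun u => (I.proj e u : ℕ)).length = I.WB
    rw [List.length_map, List.length_finRange]
  · intro v hv
    obtain ⟨u, -, rfl⟩ := List.mem_map.1 hv
    exact lt_of_lt_of_le (I.proj e u).isLt hW

/-- The degree in `toLC` of Bob's variable `v < nB` is `degB v`. [cite: AroraBarakCC2009, §22.3 (regular instances)] -/
theorem degree_toLC_bob (I : BLC) (v : Fin I.nB) : I.toLC.degree v = I.degB v := by
  unfold LabelCoverInstance.degree degB
  rw [toLC_constraints, List.countP_map, List.countP_map, countP_finRange, countP_finRange]
  have h1 : (univ.filter fun e : Fin I.m => ((fun C : LabelCoverConstraint => decide (C.fst = (v : ℕ))) ∘ I.con) e = true) =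
      univ.filter fun e : Fin I.m => I.src e = v := by
    ext e
    simp only [mem_filter, mem_univ, true_and, Function.comp_apply, decide_eq_true_eq, con]
    exact Fin.val_inj
  have h2 : (univ.filter fun e : Fin I.m => ((fun C : LabelCoverConstraint => decide (C.snd = (v : ℕ))) ∘ I.con) e = true) = ∅ := by
    rw [filter_eq_empty_iff]
    intro e _
    simp only [Function.comp_apply, decide_eq_true_eq, con]
    exact Nat.ne_of_gt (lt_of_lt_of_le v.isLt (Nat.le_add_right _ _))
  rw [h1, h2, card_empty, add_zero]

/-- The degree in `toLC` of Alice's variable `nB + u` is `degA u`. [cite: AroraBarakCC2009, §22.3 (regular instances)] -/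
theorem degree_toLC_alice (I : BLC) (u : Fin I.nA) : I.toLC.degree (I.nB + u) = I.degA u := by
  unfold LabelCoverInstance.degree degA
  rw [toLC_constraints, List.countP_map, List.countP_map, countP_finRange, countP_finRange]
  have h1 : (univ.filter fun e : Fin I.m => ((fun C : LabelCoverConstraint => decide (C.fst = I.nB + (u : ℕ))) ∘ I.con) e = true) = ∅ := by
    rw [filter_eq_empty_iff]
    intro e _
    simp only [Function.comp_apply, decide_eq_true_eq, con]
    exact Nat.ne_of_lt (lt_of_lt_of_le (I.src e).isLt (Nat.le_add_right _ _))
  have h2 : (univ.filter fun e : Fin I.m => ((fun C : LabelCoverConstraint => decide (C.snd = I.nB + (u : ℕ))) ∘ I.con) e = true) =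
      univ.filter fun e : Fin I.m => I.dst e = u := by
    ext e
    simp only [mem_filter, mem_univ, true_and, Function.comp_apply, decide_eq_true_eq, con, Nat.add_left_cancel_iff]
    exact Fin.val_inj
  rw [h1, h2, card_empty, zero_add]

/-- **Regularity** of the list rendering: if all of Bob's and all of Alice's degrees equal `D`, `toLC` is
regular. [cite: AroraBarakCC2009, §22.3 ("every variable appears in the same number of constraints")] -/
theorem isRegular_toLC (I : BLC) {D : ℕ} (hB : ∀ v, I.degB v = D) (hA : ∀ u, I.degA u = D) : I.toLC.IsRegular := by
  refine ⟨D, fun i hi => ?_⟩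
  rw [numVars_toLC] at hi
  by_cases h : i < I.nB
  · have := degree_toLC_bob I ⟨i, h⟩
    rw [hB] at this
    exact this
  · push Not at h
    obtain ⟨j, rfl⟩ := Nat.exists_eq_add_of_le h
    have hj : j < I.nA := by lia
    have := degree_toLC_alice I ⟨j, hj⟩
    rw [hA] at this
    exact this

/-- The joint assignment of a pair of strategies: Bob's labels on `0 … nB-1`, Alice's on `nB …`. [folklore] -/
def jointAssignment (I : BLC) (b : Fin I.nB → Fin I.WB) (a : Fin I.nA → Fin I.WA) (x : ℕ) : ℕ :=
  if h : x < I.nB then b ⟨x, h⟩ else if h' : x - I.nB < I.nA then a ⟨x - I.nB, h'⟩ else 0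

/-- The joint assignment on Bob's variables. [folklore] -/
theorem jointAssignment_bob (I : BLC) (b : Fin I.nB → Fin I.WB) (a : Fin I.nA → Fin I.WA) (v : Fin I.nB) :
    I.jointAssignment b a v = b v := by
  simp [jointAssignment, v.isLt]

/-- The joint assignment on Alice's variables. [folklore] -/
theorem jointAssignment_alice (I : BLC) (b : Fin I.nB → Fin I.WB) (a : Fin I.nA → Fin I.WA) (u : Fin I.nA) :
    I.jointAssignment b a (I.nB + u) = a u := by
  simp [jointAssignment, u.isLt]

/-- The constraint of edge `e` is satisfied by `x` iff `x (src e) < WB` and `proj e (x (src e)) = x (nB + dst e)`. [cite: AroraBarakCC2009, §22.3 (projection property)] -/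
theorem con_sat_iff (I : BLC) (e : Fin I.m) (x : ℕ → ℕ) :
    (I.con e).Sat x = true ↔ ∃ h : x (I.src e) < I.WB, (I.proj e ⟨x (I.src e), h⟩ : ℕ) = x (I.nB + I.dst e) := by
  rw [LabelCoverConstraint.sat_eq_true_iff]
  simp only [con]
  rw [List.getElem?_map]
  by_cases h : x (I.src e) < I.WB
  · rw [List.getElem?_eq_getElem (by rw [List.length_finRange]; exact h)]
    simp only [List.getElem_finRange, Option.map_some, Option.some.injEq, Fin.cast_mk]
    exact ⟨fun h' => ⟨h, h'⟩, fun ⟨_, h'⟩ => h'⟩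
  · rw [List.getElem?_eq_none (by rw [List.length_finRange]; exact Nat.le_of_not_lt h)]
    simp [h]

/-- **Satisfiability transfers to the list rendering**: perfect strategies give a satisfying assignment. [cite: AroraBarakCC2009, Def. 11.11 (val = 1)] -/
theorem isSatisfiable_toLC (I : BLC) {b : Fin I.nB → Fin I.WB} {a : Fin I.nA → Fin I.WA}
    (h : ∀ e, I.proj e (b (I.src e)) = a (I.dst e)) : I.toLC.IsSatisfiable := by
  refine ⟨I.jointAssignment b a, fun C hC => ?_⟩
  obtain ⟨e, rfl⟩ := (mem_constraints_toLC I).1 hC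
  rw [con_sat_iff]
  refine ⟨by rw [jointAssignment_bob]; exact (b (I.src e)).isLt, ?_⟩
  rw [jointAssignment_alice]
  have : (⟨I.jointAssignment b a (I.src e), by rw [jointAssignment_bob]; exact (b (I.src e)).isLt⟩ : Fin I.WB) = b (I.src e) :=
    Fin.ext (jointAssignment_bob I b a _)
  rw [this, h]

/-- **The value bound transfers to the list rendering**: if `val(game) ≤ θ` (`0 ≤ θ`), every assignment
`x : ℕ → ℕ` satisfies at most `θ · m` constraints of `toLC` — out-of-range labels satisfy nothing, and the
in-range part of `x` is a pair of strategies. [cite: AroraBarakCC2009, Def. 11.11 and Def. 11.13 (val(φ) < ρ)] -/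
theorem satCount_toLC_le (I : BLC) {θ : ℝ} (hθ : 0 ≤ θ) (hv : I.game.ValLe θ) (x : ℕ → ℕ) :
    (I.toLC.satCount x : ℝ) ≤ θ * I.m := by
  unfold LabelCoverInstance.satCount
  rw [toLC_constraints, List.countP_map, countP_finRange]
  -- no labels at all: nothing is satisfied
  rcases Nat.eq_zero_or_pos I.WB with hWB | hWB
  · have h0 : (univ.filter fun e : Fin I.m => ((fun C : LabelCoverConstraint => C.Sat x) ∘ I.con) e = true).card = 0 := by
      rw [card_eq_zero, filter_eq_empty_iff]
      intro e _ hs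
      obtain ⟨h, -⟩ := (con_sat_iff I e x).1 hs
      rw [hWB] at h
      exact Nat.not_lt_zero _ h
    rw [h0, Nat.cast_zero]
    exact mul_nonneg hθ (Nat.cast_nonneg _)
  · -- the in-range part of `x` as strategies
    have hWA : ∀ e : Fin I.m, 0 < I.WA := fun e => Fin.pos (I.proj e ⟨0, hWB⟩)
    set b : Fin I.nB → Fin I.WB := fun v => if h : x v < I.WB then ⟨x v, h⟩ else ⟨0, hWB⟩ with hb
    rcases Nat.eq_zero_or_pos I.m with hm | hm
    · have : (univ.filter fun e : Fin I.m => ((fun C : LabelCoverConstraint => C.Sat x) ∘ I.con) e = true).card = 0 := by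
        rw [card_eq_zero, filter_eq_empty_iff]; intro e; have := e.isLt; lia
      rw [this, hm]; simp
    have hWA' : 0 < I.WA := hWA ⟨0, hm⟩
    set a : Fin I.nA → Fin I.WA := fun u => if h : x (I.nB + u) < I.WA then ⟨x (I.nB + u), h⟩ else ⟨0, hWA'⟩ with ha
    have hle : (univ.filter fun e : Fin I.m => ((fun C : LabelCoverConstraint => C.Sat x) ∘ I.con) e = true).card ≤
        (univ.filter fun e : Fin I.m => I.proj e (b (I.src e)) = a (I.dst e)).card := by
      refine card_le_card (fun e => ?_)
      simp only [mem_filter, mem_univ, true_and, Function.comp_apply]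
      intro hs
      obtain ⟨h, h'⟩ := (con_sat_iff I e x).1 hs
      have hbv : b (I.src e) = ⟨x (I.src e), h⟩ := by rw [hb]; simp only [h, dif_pos]
      have hau : x (I.nB + I.dst e) < I.WA := by rw [← h']; exact (I.proj e _).isLt
      have hav : a (I.dst e) = ⟨x (I.nB + I.dst e), hau⟩ := by rw [ha]; simp only [hau, dif_pos]
      rw [hbv, hav]
      exact Fin.ext h'
    have hval := hv b a
    rw [satW_game, total_game] at hval
    exact le_trans (by exact_mod_cast hle) hval

end BLC

end Literature.Computability.Complexity
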